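import Summits.PneNP.PneNP.Theorems.SymmetryBudgetWindowBarrierEntropyGameCircuit
import Literature.Computability.Complexity.SymmetricColourRefinementSymmetry

/-!
# Completeness of the entropy game, II: the coset-refinement circuit is symmetric
(dichotomy `WindowBarrier` stmt-PneNP-2145 / `NoHiddenOrder` stmt-PneNP-14781, route `PneNP/SymmetryBudget`)

Continuation of `…EntropyGameCircuit.lean` (`CosetGame.crDAG K T H` on the gate type
`CosetGame.Node n K T`).  For EVERY permutation `ρ` of the vertices, renaming the input-side positions
of the gates by LEFT MULTIPLICATION (`P ↦ ρ • P` on the cosets of the type group; rounds, types and all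
target-side positions stay put; `CosetGame.Node.act ρ`) is an automorphism of the DAG over the input
map `(u, v) ↦ (ρ u, ρ v)` (`CosetGame.crDAG_isAut`): gate functions are preserved, and argument tuples
are carried to the renamed tuples up to a permutation of positions — the counted blocks
`i ↦ ⟦P.out ρᵢ⟧` are re-indexed by left multiplication in the type group by the element `a` with
`(ρ • P).out = ρ · P.out · a`, the output disjunction by `ρ` on the first one-block position.  Hence the
compiled straight-line circuit is `Sym(Fin n)`-symmetric (`CosetGame.compile_crDAG_isSymmetricUnder`)
and over `tcBasis` (`CosetGame.compile_crDAG_isOver`).  Permutation bookkeeping from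
`Literature.Computability.Complexity.SymCR` (`perm_of_comp_eq`, `blockPerm`, `consPerm`).
-/

-- `Summit.PneNP.PneNP.…` duplicates `PneNP` BY DESIGN (single-problem summit).
set_option linter.dupNamespace false

namespace Summit.PneNP.PneNP.Theorems

open Finset Literature.Computability.Complexity
open scoped Classical

namespace CosetGame

variable {n K T : ℕ}

noncomputable section

namespace Node

/-! ### The action of vertex permutations on gates -/

/-- A vertex permutation renames the input-side positions (left multiplication on cosets) and the
vertices of the literals; rounds, types and target-side positions stay put. -/
def act (ρ : Equiv.Perm (Fin n)) : Node n K T → Node n K T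
  | tt => tt
  | ff => ff
  | ex u v => ex (ρ u) (ρ v)
  | rel r A P Q => rel r A (ρ • P) Q
  | bge r A P Q BD => bge r A (ρ • P) Q BD
  | bgt r A P Q BD => bgt r A (ρ • P) Q BD
  | nbgt r A P Q BD => nbgt r A (ρ • P) Q BD
  | beq r A P Q BD => beq r A (ρ • P) Q BD
  | pge A P Q q => pge A (ρ • P) Q q
  | pgt A P Q q => pgt A (ρ • P) Q q
  | npgt A P Q q => npgt A (ρ • P) Q q
  | peq A P Q q => peq A (ρ • P) Q q
  | out => out

/-- `act ρ⁻¹` inverts `act ρ`. -/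
theorem act_inv_act (ρ : Equiv.Perm (Fin n)) (l : Node n K T) : act ρ⁻¹ (act ρ l) = l := by
  cases l <;> simp [act, smul_smul]

/-- The action as a permutation of the gate indices. -/
def actEquiv (ρ : Equiv.Perm (Fin n)) : Node n K T ≃ Node n K T where
  toFun := act ρ
  invFun := act ρ⁻¹
  left_inv := act_inv_act ρ
  right_inv l := by simpa using act_inv_act ρ⁻¹ l

/-- `actEquiv` is `act`. -/
@[simp] theorem actEquiv_apply (ρ : Equiv.Perm (Fin n)) (l : Node n K T) : actEquiv ρ l = act ρ l := rfl

/-- Gate functions are invariant. -/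
theorem fn_act (ρ : Equiv.Perm (Fin n)) (l : Node n K T) : fn (act ρ l) = fn l := by
  cases l with
  | rel r A P Q => rcases r with ⟨_ | r, hr⟩ <;> rfl
  | _ => rfl

end Node

open Node

/-! ### Relabelling of wires -/

variable (H : SimpleGraph (Fin n)) (ρ : Equiv.Perm (Fin n))

/-- The relabelling of wires induced by `ρ`: diagonal on matrix entries, `act ρ` on gates. -/
abbrev F (ρ : Equiv.Perm (Fin n)) : W n K T → W n K T := Sum.map (SymCR.diag ρ) (actEquiv (K := K) (T := T) ρ)

/-- Relabelling a literal renames its two vertices. -/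
theorem map_litW (u v : Fin n) : F ρ (litW u v : W n K T) = litW (ρ u) (ρ v) := by
  simp only [litW, ρ.injective.eq_iff]
  split_ifs <;> rfl

/-- Relabelling fixes the padding wires. -/
theorem map_pad (N θ : ℕ) (j : Fin (N + 1)) : F ρ (pad N θ j : W n K T) = pad N θ j := by
  simp only [pad]
  split_ifs <;> rfl

/-- The argument tuple of a padded counter, re-indexed: permuting the counted block by `π` (and
fixing the leading constant and the padding) is re-indexing by `blockPerm (consPerm π) 1`. -/
theorem append_cons_pad_perm {N θ : ℕ} (f : Fin N → W n K T) (π : Equiv.Perm (Fin N))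
    (a : Fin ((N + 1) + (N + 1))) :
    Fin.append (Fin.cons (Sum.inr ff) f) (pad N θ) (SymCR.blockPerm (SymCR.consPerm π) 1 a) =
      Fin.append (Fin.cons (Sum.inr ff) (f ∘ π)) (pad N θ) a := by
  rw [SymCR.append_blockPerm]
  induction a using Fin.addCases with
  | left i =>
    simp only [Fin.append_left, Function.comp_apply]
    rw [SymCR.cons_consPerm]
  | right j => simp only [Fin.append_right, Function.comp_apply, Equiv.Perm.coe_one, id_eq]

/-- **Representatives of a renamed position**: `(ρ • P).out = ρ · P.out · a` for some `a` in the
type group. -/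
theorem exists_out_smul {A : Ty n K} (P : Cos A) :
    ∃ a : A.1, (ρ • P).out = ρ * P.out * (a : Equiv.Perm (Fin n)) := by
  have hP : ρ • P = (QuotientGroup.mk (ρ * P.out) : Cos A) := by
    conv_lhs => rw [← QuotientGroup.out_eq' P]
    rfl
  obtain ⟨a, ha⟩ := QuotientGroup.mk_out_eq_mul A.1 (ρ * P.out)
  exact ⟨a, by rw [hP]; exact ha⟩

/-- Pointwise form of the representative change. -/
theorem out_smul_apply {A : Ty n K} (P : Cos A) (a : A.1)
    (ha : (ρ • P).out = ρ * P.out * (a : Equiv.Perm (Fin n))) (y : Fin n) :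
    (ρ • P).out ((a : Equiv.Perm (Fin n))⁻¹ y) = ρ (P.out y) := by
  rw [ha]
  simp [Equiv.Perm.mul_apply]

/-- The re-indexing of the type group absorbing the representative change: `i ↦` the index of
`a⁻¹ · ρᵢ`. -/
def reindex {A : Ty n K} (a : A.1) : Equiv.Perm (Fin (cardA A)) :=
  (enumA A).trans ((Rel.mulLeftEquiv a⁻¹).trans (enumA A).symm)

/-- `ρ_{reindex a i} = a⁻¹ · ρᵢ`. -/
theorem enumA_reindex {A : Ty n K} (a : A.1) (i : Fin (cardA A)) :
    (enumA A (reindex a i) : Equiv.Perm (Fin n)) = (a : Equiv.Perm (Fin n))⁻¹ * enumA A i := by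
  simp [reindex]

/-- The renamed sub-position: with `(ρ • P).out = ρ P.out a`,
`child (ρ • P) B (reindex a i) = ρ • child P B i` (indeed the representatives agree). -/
theorem out_mul_enumA_reindex {A : Ty n K} (P : Cos A) (a : A.1)
    (ha : (ρ • P).out = ρ * P.out * (a : Equiv.Perm (Fin n))) (i : Fin (cardA A)) :
    (ρ • P).out * (enumA A (reindex a i) : Equiv.Perm (Fin n)) = ρ * (P.out * (enumA A i : Equiv.Perm (Fin n))) := by
  rw [ha, enumA_reindex]
  group

/-! ### The automorphism -/

/-- **Renaming the vertices is an automorphism**: `act ρ`, over the diagonal input map, is an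
automorphism of the coset-refinement DAG, for EVERY permutation `ρ`. -/
theorem crDAG_isAut : (crDAG K T H).IsAut (SymCR.diag ρ) (actEquiv ρ) := by
  refine ⟨rfl, fun l => fn_act ρ l, fun l => ?_⟩
  show (List.ofFn (Node.args H (act ρ l))).Perm ((List.ofFn (Node.args H l)).map (F ρ))
  cases l with
  | tt => exact SymCR.perm_of_eq (n := 0) fun a => a.elim0
  | ff => exact SymCR.perm_of_eq (n := 0) fun a => a.elim0
  | ex u v => exact SymCR.perm_of_eq (n := 2) fun a => by simp only [act, args]; split_ifs <;> rfl
  | rel r A P Q =>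
    rcases r with ⟨_ | r, hr⟩
    · exact SymCR.perm_of_eq (n := 0) fun a => a.elim0
    · refine SymCR.perm_of_eq (n := 1 + (Fintype.card (Pos n K) + n * n)) fun a => ?_
      simp only [act, args]
      induction a using Fin.addCases with
      | left i => simp only [Fin.append_left]; rfl
      | right j =>
        simp only [Fin.append_right]
        induction j using Fin.addCases with
        | left i => simp only [Fin.append_left]; rfl
        | right i => simp only [Fin.append_right]; rfl
  | bge r A P Q BD =>
    obtain ⟨a, ha⟩ := exists_out_smul ρ P
    refine SymCR.perm_of_comp_eq (n := (cardA A + 1) + (cardA A + 1))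
      (SymCR.blockPerm (SymCR.consPerm (reindex a)) 1) fun c => ?_
    simp only [act, args]
    rw [append_cons_pad_perm]
    induction c using Fin.addCases with
    | left i =>
      simp only [Fin.append_left]
      refine Fin.cases ?_ (fun j => ?_) i
      · rfl
      · simp only [Fin.cons_succ, Function.comp_apply, child, out_mul_enumA_reindex ρ P a ha]
        rfl
    | right j => simp only [Fin.append_right, map_pad]
  | bgt r A P Q BD =>
    obtain ⟨a, ha⟩ := exists_out_smul ρ P
    refine SymCR.perm_of_comp_eq (n := (cardA A + 1) + (cardA A + 1))
      (SymCR.blockPerm (SymCR.consPerm (reindex a)) 1) fun c => ?_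
    simp only [act, args]
    rw [append_cons_pad_perm]
    induction c using Fin.addCases with
    | left i =>
      simp only [Fin.append_left]
      refine Fin.cases ?_ (fun j => ?_) i
      · rfl
      · simp only [Fin.cons_succ, Function.comp_apply, child, out_mul_enumA_reindex ρ P a ha]
        rfl
    | right j => simp only [Fin.append_right, map_pad]
  | nbgt r A P Q BD => exact SymCR.perm_of_eq (n := 1) fun a => rfl
  | beq r A P Q BD => exact SymCR.perm_of_eq (n := 2) fun a => by simp only [act, args]; split_ifs <;> rfl
  | pge A P Q q =>
    obtain ⟨a, ha⟩ := exists_out_smul ρ P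
    refine SymCR.perm_of_comp_eq (n := (cardA A + 1) + (cardA A + 1))
      (SymCR.blockPerm (SymCR.consPerm (reindex a)) 1) fun c => ?_
    simp only [act, args]
    rw [append_cons_pad_perm]
    induction c using Fin.addCases with
    | left i =>
      simp only [Fin.append_left]
      refine Fin.cases ?_ (fun j => ?_) i
      · rfl
      · simp only [Fin.cons_succ, Function.comp_apply, map_litW, Equiv.Perm.mul_apply, enumA_reindex,
          out_smul_apply ρ P a ha]
    | right j => simp only [Fin.append_right, map_pad]
  | pgt A P Q q =>
    obtain ⟨a, ha⟩ := exists_out_smul ρ P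
    refine SymCR.perm_of_comp_eq (n := (cardA A + 1) + (cardA A + 1))
      (SymCR.blockPerm (SymCR.consPerm (reindex a)) 1) fun c => ?_
    simp only [act, args]
    rw [append_cons_pad_perm]
    induction c using Fin.addCases with
    | left i =>
      simp only [Fin.append_left]
      refine Fin.cases ?_ (fun j => ?_) i
      · rfl
      · simp only [Fin.cons_succ, Function.comp_apply, map_litW, Equiv.Perm.mul_apply, enumA_reindex,
          out_smul_apply ρ P a ha]
    | right j => simp only [Fin.append_right, map_pad]
  | npgt A P Q q => exact SymCR.perm_of_eq (n := 1) fun a => rfl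
  | peq A P Q q => exact SymCR.perm_of_eq (n := 2) fun a => by simp only [act, args]; split_ifs <;> rfl
  | out =>
    refine SymCR.perm_of_comp_eq (n := Fintype.card (Cos (ty₀ n K) × Cos (ty₀ n K)))
      ((enumOut n K).trans (((MulAction.toPerm ρ).prodCongr (Equiv.refl _)).trans (enumOut n K).symm))
      fun c => ?_
    simp only [act, args, Equiv.trans_apply, Equiv.apply_symm_apply, Equiv.prodCongr_apply, Prod.map,
      MulAction.toPerm_apply, Equiv.refl_apply]
    rfl

/-- The DAG is symmetric under all diagonal maps of vertex permutations. -/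
theorem crDAG_isSymm : (crDAG K T H).IsSymm (GateDAG.diagMaps (Set.univ : Set (Equiv.Perm (Fin n)))) := by
  rintro π ⟨ρ', -, rfl⟩
  refine ⟨actEquiv ρ', ?_⟩
  have h : (fun q : Fin n × Fin n => (ρ' q.1, ρ' q.2)) = ⇑(SymCR.diag ρ') := funext fun q => rfl
  rw [h]
  exact crDAG_isAut H ρ'

/-- **The compiled coset-refinement circuit is `Sym(Fin n)`-symmetric.** -/
theorem compile_crDAG_isSymmetricUnder :
    (crDAG K T H).compile.IsSymmetricUnder (Set.univ : Set (Equiv.Perm (Fin n))) :=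
  (GateDAG.isSymmetricUnder_compile_iff _ _).2 (crDAG_isSymm H)

/-- The compiled coset-refinement circuit is over the threshold basis. -/
theorem compile_crDAG_isOver : (crDAG K T H).compile.IsOver tcBasis :=
  GateDAG.compile_isOver _ (crDAG_fn_mem_tcBasis H)

end

end CosetGame

end Summit.PneNP.PneNP.Theorems
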